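import Literature.NumberTheory.LFunctions.FordRowChain
import Literature.Analysis.ValidatedNumerics.IntervalLogArctan
import HarnessLib

/-!
# Kernel checker for the row chains of Ford's Table 6.1 (interval arithmetic over `MI`)

Topic `Literature/NumberTheory/LFunctions`. Everything here is PROVED; the definitions are
transparent checker functions meant to be run by the kernel (`decide +kernel`) on explicit row
certificates, and the theorems say exactly what a successful run means.

K. Ford, *Vinogradov's integral and bounds for the Riemann zeta function*, Proc. LMS 85 (2002),
Lemma 6.8 / Table 6.1: each row `(λ ∈ [k-1, k], k, n, n₀, C)` of the table certifies the bound
`S(N,t) ≤ C · N^{1 - 1/(133.66 λ²)}` for `N^{k-1} ≤ t ≤ N^k` by iterating Lemma 6.5 / Lemma 6.7 from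
the trivial bound (the chain bookkeeping `Step`, `stepF`, `stepThr`, `chainC`, `chainΔ`, `StepOK`,
`ChainOK`, `chain_sound`, `row_of_chain` lives in `FordRowChain.lean`) and then evaluating the
constant of `FordVK.row_bound`. This file mechanises the NUMERICAL side of that certification,
with the tree's constants (`η = 23/20` prime windows, target constant `12` instead of `9.463`):

* Arithmetic: the tree's fixed-point interval engine `Literature.NumericsMP.MI`
  (`Literature/Analysis/ValidatedNumerics`) at scale `SC = 2^64` with `KT = 48` series terms;
  `RowLogs` / `mkRowLogs` collect the six logarithms a row needs (`log 2`, `log k`, `log k!` via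
  `logFactMI`, `log (23/20)`, `log V`, `log π`), and `RowLogsOK` / `mkRowLogs_sound` state and prove
  that they enclose the real values.
* `stepCheck` checks, for one `Step` at `n` blocks with a scaled bracket `Δlo ≤ Δ·S ≤ Δhi` of the
  current excess, the side conditions of Lemma 6.7 (`U u`: `k+1 ≤ u`, `33 ≤ u`, `hU1`, `hU2`) resp.
  Lemma 6.5 (`V`: `4e' ≤ V^{k-1}`) in outward-rounded integer arithmetic, and returns the new
  bracket together with a scaled upper bound of `log max(T^Δ, F)` (the factor the step costs);
  `stepCheck_sound` proves this delivers `StepOK` and the stated enclosures.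
* `chainCheck` folds `stepCheck` along a `List Step`, accumulating the scaled logarithm of the
  constant; `chainCheck_sound` proves `ChainOK`, the bracket of `chainΔ`, and two-sided control of
  `log (chainC …)`.
* `rowCheck C k n₀ V l` = `mkRowLogs` + `chainCheck` from `Δ₀ = k(k-1)/2`, `C₀ = k!` + the structural
  tests (`4 ≤ k`, `1 ≤ n₀`, `k(k+1)/2 ≤ 2n₀k`, `k+1 ≤ V`, `16k⁴ ≤ V^k`, `10^8 ≤ V`), the prime-window
  test `k³ ≤ V/(200 log(1.15 V))` (what `Sylvester.card_primes_window_ge` needs), the exponent test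
  `d₁ = 1/(133.66 (k-1)²) ≤ c = (1 - (2+2Δ)/(k+1))/(2nk)`, and the final-constant test
  `(4 (k! (2πk)^k C_n)^{1/(2nk)} + 2)^{d₁/c} ≤ C` (`C` a natural-number parameter: `12` for the rows
  `k ≤ 84`, `13` for `85 ≤ k ≤ 87` with the tree's prime-window constants), all cleared of
  denominators; here `log C₀ ≤ log 4 + L₀ + e^{-L₀}/2` (`C₀ = 4e^{L₀} + 2`) and `e^{-L₀} ≤ e^{-L₀lo}` is
  evaluated through a scaled lower Taylor sum of the exponential (`expLowerScaled`,
  `expLowerScaled_le`).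
* `rowCheck_sound`: `rowCheck C k n₀ V l = true` implies exactly the hypotheses of
  `FordVK.row_of_chain` (`FordRowChain.lean`) together with the final inequality `C₀^{d₁/c} ≤ C`.

What is NOT here: no row is evaluated in this file (the per-`k` certificates
`rowCheck C k n₀ V l = true` are separate kernel computations), and the translation of a certified row into
the exponential-sum bound (supplying the prime windows from `ChebyshevSylvesterPrimeWindows`) is
done downstream.

## References

* K. Ford, Proc. London Math. Soc. (3) 85 (2002), 565–633; arXiv:1910.08209: Lemmas 6.5, 6.7,
  6.8 and Table 6.1 (Program 3). [Ford2002]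
-/

namespace Literature.NumberTheory.LFunctions
namespace FordVK

open Literature.Analysis.ValidatedNumerics Literature.Analysis.ValidatedNumerics.NumericsMP

/-- The scale of the fixed-point intervals (`2^64`) and the number of series terms. [folklore] -/
def SC : ℕ := 2 ^ 64

/-- Series terms for the `MI` logarithms. [folklore] -/
def KT : ℕ := 48

/-- The per-row logarithm data: enclosures of `log 2`, `log k`, `log k!`, `log (23/20)`, `log V`,
`log π`. [folklore] -/
structure RowLogs where
  /-- `log 2` -/
  L2 : MI
  /-- `log k` -/
  Lk : MI
  /-- `log k!` -/
  Lfact : MI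
  /-- `log (23/20)` -/
  Leta : MI
  /-- `log V` -/
  LV : MI
  /-- `log π` -/
  Lpi : MI
  deriving DecidableEq, Repr

/-- `log k! = ∑_{i=2}^{k} log i` as an interval. [folklore] -/
def logFactMI (S K : ℕ) : ℕ → Option MI
  | 0 => some (MI.ofInt S 0)
  | n + 1 =>
    match logFactMI S K n, MI.logNat2 S K (n + 1) with
    | some A, some B => some (A.add B)
    | _, _ => none

/-- The row logarithm data for degree `k` and threshold `V`. [folklore] -/
def mkRowLogs (S K k V : ℕ) : Option RowLogs :=
  match MI.logTwo S K, MI.logNat2 S K k, logFactMI S K k, MI.logNat2 S K 23, MI.logNat2 S K 20,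
    MI.logNat2 S K V, MI.pi S K with
  | some L2, some Lk, some Lf, some L23, some L20, some LV, some Lpi =>
      match MI.logPos S K Lpi with
      | some Lp => some ⟨L2, Lk, Lf, L23.sub L20, LV, Lp⟩
      | none => none
  | _, _, _, _, _, _, _ => none

/-- One step of the checker at `n` blocks with the scaled bracket `Δlo ≤ Δ·S ≤ Δhi`: verifies the
side condition `StepOK` of the step and returns the new bracket and a scaled upper bound of the
logarithm of the step's factor `max(T^Δ, F)`. [cite: Ford2002, proof of Lemma 6.8] -/
def stepCheck (S K k V : ℕ) (R : RowLogs) (n : ℕ) (Δlo Δhi : ℤ) : Step → Option (ℤ × ℤ × ℤ)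
  | .U u =>
    let s : ℕ := n * k
    let half : ℕ := k * (k + 1) / 2
    let Elo : ℤ := ((2 * s + 2 : ℕ) : ℤ) * S - ((half : ℕ) : ℤ) * S + (Δlo * ((k : ℤ) - 1)) / (k : ℤ)
    let ehi : ℤ := ((2 * (s + k) : ℕ) : ℤ) * S - ((half : ℕ) : ℤ) * S + Numerics.cdiv (Δhi * ((k : ℤ) - 1)) k
    match MI.logNat2 S K u, MI.logNat2 S K (k * (n + 1)) with
    | some Lu, some LK =>
      if k + 1 ≤ u ∧ 33 ≤ u ∧ 0 ≤ Δlo ∧ Δlo ≤ Δhi ∧ Δhi ≤ ((k * k : ℕ) : ℤ) * S ∧ 0 ≤ Lu.lo ∧ 0 ≤ Elo ∧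
          (S : ℤ) * (R.L2.hi * 3 + ((2 * k + 2 * s : ℕ) : ℤ) * R.Lk.hi) ≤ Elo * Lu.lo ∧
          4 * ehi ≤ ((u ^ (k - 1) : ℕ) : ℤ) * S ∧ 0 ≤ R.Leta.hi ∧ 0 ≤ Lu.hi then
        let A : ℤ := Numerics.cdiv (Δhi * Lu.hi) S
        let F : ℤ := R.L2.hi * 3 + (k : ℤ) * R.L2.hi + R.Lfact.hi + 2 * ((k : ℤ) * LK.hi - R.Lfact.lo)
          + Numerics.cdiv ((((k * k : ℕ) : ℤ) * S - Δlo) * R.Leta.hi) S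
        some ((Δlo * ((k : ℤ) - 1)) / (k : ℤ), Numerics.cdiv (Δhi * ((k : ℤ) - 1)) k, max A F)
      else none
    | _, _ => none
  | .V =>
    let s : ℕ := n * k
    let half : ℕ := k * (k + 1) / 2
    let ehi : ℤ := ((2 * (s + k) : ℕ) : ℤ) * S - ((half : ℕ) : ℤ) * S + Numerics.cdiv (Δhi * ((k : ℤ) - 1)) k
    if 0 ≤ Δlo ∧ Δlo ≤ Δhi ∧ Δhi ≤ ((k * k : ℕ) : ℤ) * S ∧ 4 * ehi ≤ ((V ^ (k - 1) : ℕ) : ℤ) * S ∧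
        0 ≤ R.Leta.hi ∧ 0 ≤ R.LV.hi then
      let A : ℤ := Numerics.cdiv (Δhi * R.LV.hi) S
      let F : ℤ := R.L2.hi * 2 + 3 * R.Lk.hi + R.Lfact.hi
        + Numerics.cdiv ((((k * k : ℕ) : ℤ) * S - Δlo) * R.Leta.hi) S
      some ((Δlo * ((k : ℤ) - 1)) / (k : ℤ), Numerics.cdiv (Δhi * ((k : ℤ) - 1)) k, max A F)
    else none

/-- The checker along a list of steps: returns the final `(n, Δlo, Δhi, Lacc)`. [cite: Ford2002, proof of Lemma 6.8] -/
def chainCheck (S K k V : ℕ) (R : RowLogs) : ℕ → ℤ → ℤ → ℤ → List Step → Option (ℕ × ℤ × ℤ × ℤ)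
  | n, Δlo, Δhi, L, [] => some (n, Δlo, Δhi, L)
  | n, Δlo, Δhi, L, st :: rest =>
    match stepCheck S K k V R n Δlo Δhi st with
    | some (Δlo', Δhi', c) => chainCheck S K k V R (n + 1) Δlo' Δhi' (L + c) rest
    | none => none

/-- Scaled lower Taylor sums of the exponential: `expLowerScaled W N i = (t_i, s_i)` with
`t_0 = s_0 = W`, `t_{i+1} = ⌊t_i N / ((i+1) W)⌋`, `s_{i+1} = s_i + t_{i+1}`; for `0 ≤ N`, `0 < W` one has
`s_i ≤ W e^{N/W}` (`expLowerScaled_le`). [folklore] -/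
def expLowerScaled (W N : ℤ) : ℕ → ℤ × ℤ
  | 0 => (W, W)
  | i + 1 =>
    let p := expLowerScaled W N i
    let t := p.1 * N / (((i + 1 : ℕ) : ℤ) * W)
    (t, p.2 + t)

/-- **The row checker.** Target constant `C`, degree `k`, start `n₀` blocks, threshold `V`, steps
`l`: verifies all side conditions, the exponent condition `d₁ ≤ c`, and the final constant
`C₀^{d₁/c} ≤ C`. [cite: Ford2002, Lemma 6.8 (Table 6.1)] -/
def rowCheck (C k n₀ V : ℕ) (l : List Step) : Bool :=
  let S := SC
  match mkRowLogs S KT k V with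
  | none => false
  | some R =>
    let Δ0 : ℤ := ((k * (k - 1) / 2 : ℕ) : ℤ) * S
    match chainCheck S KT k V R n₀ Δ0 Δ0 0 l with
    | none => false
    | some (n, _Δlo, Δhi, L) =>
      -- structural conditions
      decide (4 ≤ k ∧ 1 ≤ n₀ ∧ k * (k + 1) ≤ 4 * (n₀ * k) ∧ k + 1 ≤ V ∧ 16 * k ^ 4 ≤ V ^ k ∧ 100000000 ≤ V) &&
      -- `V/(200 log(1.15 V)) ≥ k³` : `V · S ≥ 200 k³ (log V + log 1.15)_hi`
      decide (0 ≤ R.LV.hi + R.Leta.hi ∧ 200 * ((k ^ 3 : ℕ) : ℤ) * (R.LV.hi + R.Leta.hi) ≤ (V : ℤ) * S) &&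
      -- exponent condition `d₁ ≤ c_lo`, cleared of denominators:
      -- `100 (k+1) S · 2nk ≤ 13366 (k-1)² ((k-1) S − 2 Δhi)`
      (let lhs : ℤ := 100 * ((k + 1 : ℕ) : ℤ) * S * ((2 * n * k : ℕ) : ℤ)
       let rhs : ℤ := 13366 * (((k - 1) ^ 2 : ℕ) : ℤ) * (((k - 1 : ℕ) : ℤ) * S - 2 * Δhi)
       decide (0 < ((k - 1 : ℕ) : ℤ) * S - 2 * Δhi ∧ lhs ≤ rhs) &&
       -- final constant: ρ = lhs/rhs; we require `62 lhs ≤ 10 rhs` (1/ρ ≥ 6.2) and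
       -- `ρ (log 4 + L₀hi + 1/(2(1+L₀lo))) ≤ log C`, all scaled by `S · 2nk`:
       (let twonk : ℤ := ((2 * n * k : ℕ) : ℤ)
        let N0hi : ℤ := R.Lfact.hi + (k : ℤ) * (R.L2.hi + R.Lpi.hi + R.Lk.hi) + R.Lfact.hi + L   -- ≥ 2nk·S·L₀
        let N0lo : ℤ := ((l.length : ℕ) : ℤ) * (R.Lfact.lo + (((k * (k + 1) / 2 : ℕ) : ℤ)) * R.Leta.lo)  -- ≤ 2nk·S·L₀
        let log4hi : ℤ := 2 * R.L2.hi
        -- `Es ≤ W e^{L₀lo}` (`W = S·2nk`, `L₀lo = N0lo/W`): scaled lower Taylor sum of the exponential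
        let W : ℤ := (S : ℤ) * twonk
        let Es : ℤ := (expLowerScaled W N0lo 12).2
        decide (62 * lhs ≤ 10 * rhs ∧ 0 ≤ N0lo ∧ 0 < Es) &&
        (match MI.logNat2 S KT C with
         | none => false
         | some LC =>
           -- `ρ · (log 4 + N0hi/W + e^{-L₀lo}/2)` ≤ `log C`; multiply by rhs · W:
           --   lhs · (log4hi · 2nk + N0hi + T) ≤ rhs · 2nk · LC.lo,  T := ⌈W²/(2 Es)⌉ ≥ W · e^{-L₀lo}/2
           let T : ℤ := Numerics.cdiv (W * W) (2 * Es)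
           decide (lhs * (log4hi * twonk + N0hi + T) ≤ rhs * twonk * LC.lo))))

/-! ### Soundness: the logarithm data -/

/-- The meaning of the row logarithm data. [folklore] -/
def RowLogsOK (S k V : ℕ) (R : RowLogs) : Prop :=
  MI.mem S (Real.log 2) R.L2 ∧ MI.mem S (Real.log k) R.Lk ∧ MI.mem S (Real.log (Nat.factorial k)) R.Lfact ∧
    MI.mem S (Real.log (23 / 20)) R.Leta ∧ MI.mem S (Real.log V) R.LV ∧ MI.mem S (Real.log Real.pi) R.Lpi

/-- `logFactMI` encloses `log n!`. [folklore] -/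
theorem logFactMI_sound {S K : ℕ} (hS : 0 < S) : ∀ {n : ℕ} {Y : MI}, logFactMI S K n = some Y →
    MI.mem S (Real.log (Nat.factorial n)) Y
  | 0, Y, h => by
    simp only [logFactMI, Option.some.injEq] at h
    subst h
    simpa using MI.mem_ofInt S 0
  | n + 1, Y, h => by
    simp only [logFactMI] at h
    split at h
    · rename_i A B hA hB
      simp only [Option.some.injEq] at h
      subst h
      have h1 := logFactMI_sound hS hA
      have h2 := MI.mem_logNat2 hS hB
      rw [Nat.factorial_succ, Nat.cast_mul, Real.log_mul (by positivity) (by positivity), add_comm]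
      exact MI.mem_add h1 h2
    · simp at h

/-- `mkRowLogs` is sound. [folklore] -/
theorem mkRowLogs_sound {S K k V : ℕ} (hS : 0 < S) {R : RowLogs} (h : mkRowLogs S K k V = some R) :
    RowLogsOK S k V R := by
  unfold mkRowLogs at h
  split at h
  · rename_i L2 Lk Lf L23 L20 LV Lpi hL2 hLk hLf hL23 hL20 hLV hLpi
    split at h
    · rename_i Lp hLp
      simp only [Option.some.injEq] at h
      subst h
      refine ⟨MI.mem_logTwo hS hL2, MI.mem_logNat2 hS hLk, logFactMI_sound hS hLf, ?_, MI.mem_logNat2 hS hLV, ?_⟩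
      · have := MI.mem_sub (MI.mem_logNat2 hS hL23) (MI.mem_logNat2 hS hL20)
        rwa [← Real.log_div (by norm_num) (by norm_num), show ((23 : ℕ) : ℝ) / ((20 : ℕ) : ℝ) = 23 / 20 by norm_num] at this
      · exact (MI.mem_logPos hS hLp (MI.mem_pi S hLpi)).2
    · simp at h
  · simp at h

/-! ### Soundness: one step -/

/-- `log (max x y) · S ≤ max A B` from `log x · S ≤ A`, `log y · S ≤ B`. [folklore] -/
theorem log_max_mul_le {x y A B : ℝ} {S : ℝ} (hA : Real.log x * S ≤ A)
    (hB : Real.log y * S ≤ B) : Real.log (max x y) * S ≤ max A B := by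
  rcases le_total x y with h | h
  · rw [max_eq_right h]; exact hB.trans (le_max_right _ _)
  · rw [max_eq_left h]; exact hA.trans (le_max_left _ _)

/-- `log C(k+s, k) ≤ k log (k+s) − log k!` (`C(n,r) ≤ nʳ/r!`). [folklore] -/
theorem log_choose_le (k s : ℕ) :
    Real.log (((k + s).choose k : ℕ) : ℝ) ≤ k * Real.log ((k + s : ℕ) : ℝ) - Real.log (Nat.factorial k) := by
  have h1 : (((k + s).choose k : ℕ) : ℝ) ≤ ((k + s : ℕ) : ℝ) ^ k / (Nat.factorial k) := by
    have := Nat.choose_le_pow_div (α := ℝ) k (k + s)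
    push_cast at this ⊢; exact this
  have hc0 : (0 : ℝ) < (((k + s).choose k : ℕ) : ℝ) := by
    exact_mod_cast Nat.choose_pos (Nat.le_add_right k s)
  have hf0 : (0 : ℝ) < (Nat.factorial k : ℝ) := by exact_mod_cast Nat.factorial_pos k
  rcases Nat.eq_zero_or_pos (k + s) with h0 | hpos
  · have hk0 : k = 0 := by omega
    subst hk0; simp
  have hK0 : (0 : ℝ) < ((k + s : ℕ) : ℝ) := by exact_mod_cast hpos
  calc Real.log (((k + s).choose k : ℕ) : ℝ) ≤ Real.log (((k + s : ℕ) : ℝ) ^ k / (Nat.factorial k)) :=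
        Real.log_le_log hc0 h1
    _ = k * Real.log ((k + s : ℕ) : ℝ) - Real.log (Nat.factorial k) := by
        rw [Real.log_div (by positivity) hf0.ne', Real.log_pow]

set_option maxHeartbeats 1600000 in
/-- **Soundness of `stepCheck`**: the side condition `StepOK` of the step holds for every real `Δ`
in the bracket, the bracket propagates to `Δ(1 - 1/k)`, and `c/S` bounds the logarithm of the step
factor `max(T^Δ, F)` (with `η = 23/20`). [cite: Ford2002, proof of Lemma 6.8] -/
theorem stepCheck_sound {S K k V : ℕ} (hS : 0 < S) (hk : 2 ≤ k) (hV1 : 1 ≤ V) {R : RowLogs}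
    (hR : RowLogsOK S k V R) {n : ℕ} {Δlo Δhi : ℤ} {Δ : ℝ} (hlo : (Δlo : ℝ) ≤ Δ * S) (hhi : Δ * S ≤ Δhi)
    {st : Step} {Δlo' Δhi' c : ℤ} (h : stepCheck S K k V R n Δlo Δhi st = some (Δlo', Δhi', c)) :
    StepOK k (V : ℝ) n Δ st ∧ (Δlo' : ℝ) ≤ Δ * (1 - 1 / k) * S ∧ Δ * (1 - 1 / k) * S ≤ Δhi' ∧
      0 ≤ Δ ∧ Δ ≤ (k : ℝ) ^ 2 ∧
      Real.log (max ((stepThr (V : ℝ) st) ^ Δ) (stepF k (n * k) Δ (23 / 20) st)) * S ≤ c := by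
  have hSr : (0 : ℝ) < S := by exact_mod_cast hS
  have hkr : (2 : ℝ) ≤ k := by exact_mod_cast hk
  have hk0 : (0 : ℝ) < k := by linarith
  have hkz : (0 : ℤ) < k := by exact_mod_cast (by omega : 0 < k)
  obtain ⟨hL2, hLk, hLf, hLeta, hLV, hLpi⟩ := hR
  have hη0 : 0 ≤ Real.log (23 / 20 : ℝ) := Real.log_nonneg (by norm_num)
  -- the half-integer `k(k+1)/2`
  have hhalfR : (((k * (k + 1) / 2 : ℕ) : ℤ) : ℝ) = (k : ℝ) * ((k : ℝ) + 1) / 2 := by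
    rw [Int.cast_natCast]; exact cast_mul_succ_div_two k
  -- bracket propagation
  have hq : (1 - 1 / (k : ℝ)) = ((k : ℝ) - 1) / k := by field_simp
  have hqk0 : 0 ≤ ((k : ℝ) - 1) / k := div_nonneg (by linarith) hk0.le
  have hΔ'lo : (((Δlo * ((k : ℤ) - 1)) / (k : ℤ) : ℤ) : ℝ) ≤ Δ * (1 - 1 / k) * S := by
    have h1 := Numerics.fdiv_le_div (a := Δlo * ((k : ℤ) - 1)) hkz
    refine h1.trans ?_
    have e : (((Δlo * ((k : ℤ) - 1)) : ℤ) : ℝ) / ((k : ℤ) : ℝ) = (Δlo : ℝ) * (((k : ℝ) - 1) / k) := by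
      push_cast; ring
    rw [e, hq, show Δ * (((k : ℝ) - 1) / k) * S = (Δ * S) * (((k : ℝ) - 1) / k) by ring]
    exact mul_le_mul_of_nonneg_right hlo hqk0
  have hΔ'hi : Δ * (1 - 1 / k) * S ≤ ((Numerics.cdiv (Δhi * ((k : ℤ) - 1)) k : ℤ) : ℝ) := by
    have h1 := Numerics.div_le_cdiv (a := Δhi * ((k : ℤ) - 1)) hkz
    refine le_trans ?_ h1
    have e : (((Δhi * ((k : ℤ) - 1)) : ℤ) : ℝ) / ((k : ℤ) : ℝ) = (Δhi : ℝ) * (((k : ℝ) - 1) / k) := by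
      push_cast; ring
    rw [e, hq, show Δ * (((k : ℝ) - 1) / k) * S = (Δ * S) * (((k : ℝ) - 1) / k) by ring]
    exact mul_le_mul_of_nonneg_right hhi hqk0
  -- atoms of the logarithm data
  have a2 : Real.log 2 * S ≤ R.L2.hi := hL2.2
  have ak : Real.log k * S ≤ R.Lk.hi := hLk.2
  have af : Real.log (Nat.factorial k) * S ≤ R.Lfact.hi := hLf.2
  have af' : (R.Lfact.lo : ℝ) ≤ Real.log (Nat.factorial k) * S := hLf.1
  have aη : Real.log (23 / 20 : ℝ) * S ≤ R.Leta.hi := hLeta.2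
  have aV : Real.log V * S ≤ R.LV.hi := hLV.2
  have hf0 : (0 : ℝ) < (Nat.factorial k : ℝ) := by exact_mod_cast Nat.factorial_pos k
  have hlog4 : Real.log 4 = 2 * Real.log 2 := by
    rw [show (4 : ℝ) = 2 ^ 2 by norm_num, Real.log_pow]; norm_num
  have hlog8 : Real.log 8 = 3 * Real.log 2 := by
    rw [show (8 : ℝ) = 2 ^ 3 by norm_num, Real.log_pow]; norm_num
  -- the `η`-term bound, common to both cases
  have hηterm : ∀ {Δlo : ℤ}, (Δlo : ℝ) ≤ Δ * S → Δ ≤ (k : ℝ) ^ 2 → 0 ≤ R.Leta.hi →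
      ((k : ℝ) ^ 2 - Δ) * Real.log (23 / 20) * S
        ≤ ((Numerics.cdiv ((((k * k : ℕ) : ℤ) * S - Δlo) * R.Leta.hi) S : ℤ) : ℝ) := by
    intro Δlo hlo hΔk hLetahi0
    have e6 := Numerics.div_le_cdiv (a := (((k * k : ℕ) : ℤ) * S - Δlo) * R.Leta.hi) (b := S)
      (by exact_mod_cast hS)
    refine le_trans ?_ e6
    rw [le_div_iff₀ (by exact_mod_cast hSr)]
    push_cast
    have ha : ((k : ℝ) ^ 2 - Δ) * S ≤ (k : ℝ) * k * S - Δlo := by nlinarith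
    have ha0 : 0 ≤ ((k : ℝ) ^ 2 - Δ) * S := mul_nonneg (by linarith) hSr.le
    have hLη0 : (0 : ℝ) ≤ R.Leta.hi := by exact_mod_cast hLetahi0
    calc ((k : ℝ) ^ 2 - Δ) * Real.log (23 / 20) * S * S
        = (((k : ℝ) ^ 2 - Δ) * S) * (Real.log (23 / 20) * S) := by ring
      _ ≤ ((k : ℝ) * k * S - Δlo) * R.Leta.hi := mul_le_mul ha aη (mul_nonneg hη0 hSr.le) (ha0.trans ha)
  cases st with
  | U u =>
    simp only [stepCheck] at h
    split at h
    · rename_i Lu LK hLu hLK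
      split_ifs at h with hc
      simp only [Option.some.injEq, Prod.mk.injEq] at h
      obtain ⟨rfl, rfl, rfl⟩ := h
      obtain ⟨hu1, hu33, hΔlo0, hlohi, hhik, hLulo0, hElo0, hU1, hU2, hLetahi0, hLuhi0⟩ := hc
      have hmu := MI.mem_logNat2 hS hLu
      have hmK := MI.mem_logNat2 hS hLK
      have hΔ0 : 0 ≤ Δ := by
        have : (0 : ℝ) ≤ Δ * S := le_trans (by exact_mod_cast hΔlo0) hlo
        nlinarith
      have hΔk : Δ ≤ (k : ℝ) ^ 2 := by
        have : Δ * S ≤ ((k * k : ℕ) : ℤ) * S := hhi.trans (by exact_mod_cast hhik)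
        push_cast at this
        nlinarith
      have hu33r : (33 : ℝ) ≤ u := by exact_mod_cast hu33
      have hu0 : (0 : ℝ) < u := by linarith
      have hlogu0 : 0 ≤ Real.log u := Real.log_nonneg (by linarith)
      have au : Real.log u * S ≤ Lu.hi := hmu.2
      have au' : (Lu.lo : ℝ) ≤ Real.log u * S := hmu.1
      have aK : Real.log ((k * (n + 1) : ℕ) : ℝ) * S ≤ LK.hi := hmK.2
      -- the two integer expressions, read in `ℝ`
      set Elo : ℤ := ((2 * (n * k) + 2 : ℕ) : ℤ) * S - ((k * (k + 1) / 2 : ℕ) : ℤ) * S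
        + (Δlo * ((k : ℤ) - 1)) / (k : ℤ) with hElo_def
      set ehi : ℤ := ((2 * (n * k + k) : ℕ) : ℤ) * S - ((k * (k + 1) / 2 : ℕ) : ℤ) * S
        + Numerics.cdiv (Δhi * ((k : ℤ) - 1)) k with hehi_def
      set E : ℝ := ((2 * (n * k : ℕ) : ℝ) + 2 - k * (k + 1) / 2 + Δ * (1 - 1 / k)) with hE
      set e' : ℝ := ((2 * ((n * k : ℕ) + k) : ℝ) - k * (k + 1) / 2 + Δ * (1 - 1 / k)) with he'
      have hEloR : (Elo : ℝ) ≤ E * S := by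
        have e1 : (Elo : ℝ) = ((2 * (n * k) + 2 : ℕ) : ℝ) * S - (k : ℝ) * ((k : ℝ) + 1) / 2 * S
            + (((Δlo * ((k : ℤ) - 1)) / (k : ℤ) : ℤ) : ℝ) := by
          rw [hElo_def]; push_cast; rw [hhalfR.symm]; push_cast; ring
        calc (Elo : ℝ) = _ := e1
          _ ≤ ((2 * (n * k) + 2 : ℕ) : ℝ) * S - (k : ℝ) * ((k : ℝ) + 1) / 2 * S + Δ * (1 - 1 / k) * S :=
              by linarith [hΔ'lo]
          _ = E * S := by rw [hE]; push_cast; ring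
      have hehiR : e' * S ≤ (ehi : ℝ) := by
        have e1 : (ehi : ℝ) = ((2 * (n * k + k) : ℕ) : ℝ) * S - (k : ℝ) * ((k : ℝ) + 1) / 2 * S
            + ((Numerics.cdiv (Δhi * ((k : ℤ) - 1)) k : ℤ) : ℝ) := by
          rw [hehi_def]; push_cast; rw [hhalfR.symm]; push_cast; ring
        calc e' * S = ((2 * (n * k + k) : ℕ) : ℝ) * S - (k : ℝ) * ((k : ℝ) + 1) / 2 * S
              + Δ * (1 - 1 / k) * S := by rw [he']; push_cast; ring
          _ ≤ ((2 * (n * k + k) : ℕ) : ℝ) * S - (k : ℝ) * ((k : ℝ) + 1) / 2 * S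
              + ((Numerics.cdiv (Δhi * ((k : ℤ) - 1)) k : ℤ) : ℝ) := by linarith [hΔ'hi]
          _ = (ehi : ℝ) := e1.symm
      have hElo0R : (0 : ℝ) ≤ (Elo : ℝ) := by exact_mod_cast hElo0
      have hES0 : 0 ≤ E * S := hElo0R.trans hEloR
      have hE0 : 0 ≤ E := nonneg_of_mul_nonneg_left hES0 hSr
      refine ⟨⟨?_, hu33r, ?_, ?_⟩, hΔ'lo, hΔ'hi, hΔ0, hΔk, ?_⟩
      · exact_mod_cast hu1
      · -- hU1
        have hU1r : (S : ℝ) * (R.L2.hi * 3 + ((2 * k + 2 * (n * k) : ℕ) : ℝ) * R.Lk.hi) ≤ (Elo : ℝ) * Lu.lo := by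
          exact_mod_cast hU1
        have hLulo0r : (0 : ℝ) ≤ Lu.lo := by exact_mod_cast hLulo0
        have h2 : (Elo : ℝ) * Lu.lo ≤ (E * S) * (S * Real.log u) :=
          calc (Elo : ℝ) * Lu.lo ≤ (E * S) * Lu.lo := mul_le_mul_of_nonneg_right hEloR hLulo0r
            _ ≤ (E * S) * (S * Real.log u) := mul_le_mul_of_nonneg_left (by linarith) hES0
        set c₁ : ℝ := ((2 * k + 2 * (n * k) : ℕ) : ℝ) with hc₁
        have hc₁0 : 0 ≤ c₁ := Nat.cast_nonneg _
        have h3 : (S : ℝ) * (S * (3 * Real.log 2 + c₁ * Real.log k))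
            ≤ (S : ℝ) * (R.L2.hi * 3 + c₁ * R.Lk.hi) := by
          refine mul_le_mul_of_nonneg_left ?_ hSr.le
          have : c₁ * (Real.log k * S) ≤ c₁ * R.Lk.hi := mul_le_mul_of_nonneg_left ak hc₁0
          nlinarith
        have h4 : (S : ℝ) * S * (3 * Real.log 2 + c₁ * Real.log k) ≤ (S : ℝ) * S * (E * Real.log u) := by
          have := (h3.trans hU1r).trans h2; nlinarith
        have hlhs : 3 * Real.log 2 + c₁ * Real.log k ≤ E * Real.log u :=
          le_of_mul_le_mul_left h4 (by positivity)
        calc 8 * (k : ℝ) ^ (2 * k + 2 * (n * k))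
            = Real.exp (3 * Real.log 2 + c₁ * Real.log k) := by
              rw [Real.exp_add, ← hlog8, Real.exp_log (by norm_num), hc₁, ← Real.rpow_natCast,
                Real.rpow_def_of_pos hk0, mul_comm (Real.log k)]
          _ ≤ Real.exp (E * Real.log u) := Real.exp_le_exp.2 hlhs
          _ = (u : ℝ) ^ E := by rw [Real.rpow_def_of_pos hu0, mul_comm]
      · -- hU2
        have h2 : 4 * (ehi : ℝ) ≤ ((u : ℝ) ^ (k - 1)) * S := by exact_mod_cast hU2
        have h3 : 4 * e' * S ≤ (u : ℝ) ^ (k - 1) * S := by nlinarith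
        have h4 : 4 * e' ≤ (u : ℝ) ^ (k - 1) := le_of_mul_le_mul_right h3 hSr
        rwa [← Real.rpow_natCast, Nat.cast_sub (by omega : 1 ≤ k), Nat.cast_one] at h4
      · -- the cost
        rw [Int.cast_max]
        refine log_max_mul_le ?_ ?_
        · simp only [stepThr]
          rw [Real.log_rpow hu0]
          have h1 := Numerics.div_le_cdiv (a := Δhi * Lu.hi) (b := S) (by exact_mod_cast hS)
          refine le_trans ?_ h1
          push_cast
          rw [le_div_iff₀ hSr]
          have hΔhi0 : (0 : ℝ) ≤ Δhi := le_trans (by nlinarith) hhi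
          calc Δ * Real.log u * S * S = (Δ * S) * (Real.log u * S) := by ring
            _ ≤ (Δhi : ℝ) * (Lu.hi : ℝ) := mul_le_mul hhi au (by positivity) hΔhi0
        · simp only [stepF]
          have hC0 : (0 : ℝ) < (((k + n * k).choose k : ℕ) : ℝ) := by
            exact_mod_cast Nat.choose_pos (Nat.le_add_right k _)
          rw [Real.log_mul (by positivity) (by positivity), Real.log_mul (by positivity) (by positivity),
            Real.log_mul (by positivity) (by positivity), Real.log_mul (by positivity) (by positivity),
            Real.log_rpow (by norm_num), Real.log_pow, Real.log_pow, hlog8]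
          have hch := log_choose_le k (n * k)
          have hKeq : ((k + n * k : ℕ) : ℝ) = ((k * (n + 1) : ℕ) : ℝ) := by push_cast; ring
          rw [hKeq] at hch
          -- multiplied atoms
          have m1 : (k : ℝ) * (Real.log 2 * S) ≤ (k : ℝ) * R.L2.hi := mul_le_mul_of_nonneg_left a2 hk0.le
          have m2 : Real.log (((k + n * k).choose k : ℕ) : ℝ) * S
              ≤ (k : ℝ) * LK.hi - R.Lfact.lo := by
            have : (k : ℝ) * (Real.log ((k * (n + 1) : ℕ) : ℝ) * S) ≤ (k : ℝ) * LK.hi :=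
              mul_le_mul_of_nonneg_left aK hk0.le
            nlinarith
          have m3 := hηterm hlo hΔk hLetahi0
          push_cast at m3 ⊢
          nlinarith [m1, m2, m3, a2, af]
    · simp at h
  | V =>
    simp only [stepCheck] at h
    split_ifs at h with hc
    simp only [Option.some.injEq, Prod.mk.injEq] at h
    obtain ⟨rfl, rfl, rfl⟩ := h
    obtain ⟨hΔlo0, hlohi, hhik, hV2, hLetahi0, hLVhi0⟩ := hc
    have hΔ0 : 0 ≤ Δ := by
      have : (0 : ℝ) ≤ Δ * S := le_trans (by exact_mod_cast hΔlo0) hlo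
      nlinarith
    have hΔk : Δ ≤ (k : ℝ) ^ 2 := by
      have : Δ * S ≤ ((k * k : ℕ) : ℤ) * S := hhi.trans (by exact_mod_cast hhik)
      push_cast at this
      nlinarith
    have hVr : (1 : ℝ) ≤ V := by exact_mod_cast hV1
    have hV0 : (0 : ℝ) < V := by linarith
    set ehi : ℤ := ((2 * (n * k + k) : ℕ) : ℤ) * S - ((k * (k + 1) / 2 : ℕ) : ℤ) * S
      + Numerics.cdiv (Δhi * ((k : ℤ) - 1)) k with hehi_def
    set e' : ℝ := ((2 * ((n * k : ℕ) + k) : ℝ) - k * (k + 1) / 2 + Δ * (1 - 1 / k)) with he'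
    have hehiR : e' * S ≤ (ehi : ℝ) := by
      have e1 : (ehi : ℝ) = ((2 * (n * k + k) : ℕ) : ℝ) * S - (k : ℝ) * ((k : ℝ) + 1) / 2 * S
          + ((Numerics.cdiv (Δhi * ((k : ℤ) - 1)) k : ℤ) : ℝ) := by
        rw [hehi_def]; push_cast; rw [hhalfR.symm]; push_cast; ring
      calc e' * S = ((2 * (n * k + k) : ℕ) : ℝ) * S - (k : ℝ) * ((k : ℝ) + 1) / 2 * S
            + Δ * (1 - 1 / k) * S := by rw [he']; push_cast; ring
        _ ≤ ((2 * (n * k + k) : ℕ) : ℝ) * S - (k : ℝ) * ((k : ℝ) + 1) / 2 * S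
            + ((Numerics.cdiv (Δhi * ((k : ℤ) - 1)) k : ℤ) : ℝ) := by linarith [hΔ'hi]
        _ = (ehi : ℝ) := e1.symm
    refine ⟨?_, hΔ'lo, hΔ'hi, hΔ0, hΔk, ?_⟩
    · simp only [StepOK]
      have h2 : 4 * (ehi : ℝ) ≤ ((V : ℝ) ^ (k - 1)) * S := by exact_mod_cast hV2
      have h3 : 4 * e' * S ≤ (V : ℝ) ^ (k - 1) * S := by nlinarith
      exact le_of_mul_le_mul_right h3 hSr
    · rw [Int.cast_max]
      refine log_max_mul_le ?_ ?_
      · simp only [stepThr]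
        rw [Real.log_rpow hV0]
        have h1 := Numerics.div_le_cdiv (a := Δhi * R.LV.hi) (b := S) (by exact_mod_cast hS)
        refine le_trans ?_ h1
        push_cast
        rw [le_div_iff₀ hSr]
        have hΔhi0 : (0 : ℝ) ≤ Δhi := le_trans (by nlinarith) hhi
        calc Δ * Real.log V * S * S = (Δ * S) * (Real.log V * S) := by ring
          _ ≤ (Δhi : ℝ) * (R.LV.hi : ℝ) :=
              mul_le_mul hhi aV (mul_nonneg (Real.log_nonneg hVr) hSr.le) hΔhi0
      · simp only [stepF]
        rw [Real.log_mul (by positivity) (by positivity), Real.log_mul (by positivity) (by positivity),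
          Real.log_mul (by positivity) (by positivity), Real.log_rpow (by norm_num), Real.log_pow, hlog4]
        have m1 : (3 : ℝ) * (Real.log k * S) ≤ 3 * R.Lk.hi := by nlinarith
        have m3 := hηterm hlo hΔk hLetahi0
        push_cast at m3 ⊢
        nlinarith [m1, m3, a2, af]

/-! ### Soundness: the chain -/

/-- The step factor is at least `k! · η^{k²-Δ}` (`η = 23/20`). [folklore] -/
theorem stepF_ge (k s : ℕ) (hk : 1 ≤ k) {Δ : ℝ} (st : Step) :
    (Nat.factorial k : ℝ) * (23 / 20 : ℝ) ^ ((k : ℝ) ^ 2 - Δ) ≤ stepF k s Δ (23 / 20) st := by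
  have hf0 : (0 : ℝ) ≤ (Nat.factorial k : ℝ) := Nat.cast_nonneg _
  have hη : (0 : ℝ) ≤ (23 / 20 : ℝ) ^ ((k : ℝ) ^ 2 - Δ) := Real.rpow_nonneg (by norm_num) _
  cases st with
  | U u =>
    simp only [stepF]
    have hC : (1 : ℝ) ≤ (((k + s).choose k : ℕ) : ℝ) := by
      exact_mod_cast Nat.choose_pos (Nat.le_add_right k s)
    have h1 : (1 : ℝ) ≤ 8 * 2 ^ k * (((k + s).choose k : ℕ) : ℝ) ^ 2 := by
      have : (1 : ℝ) ≤ 2 ^ k := one_le_pow₀ (by norm_num)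
      nlinarith
    calc (Nat.factorial k : ℝ) * (23 / 20 : ℝ) ^ ((k : ℝ) ^ 2 - Δ)
        = 1 * ((Nat.factorial k : ℝ) * (23 / 20 : ℝ) ^ ((k : ℝ) ^ 2 - Δ)) := by ring
      _ ≤ (8 * 2 ^ k * (((k + s).choose k : ℕ) : ℝ) ^ 2) * ((Nat.factorial k : ℝ) * (23 / 20 : ℝ) ^ ((k : ℝ) ^ 2 - Δ)) :=
          mul_le_mul_of_nonneg_right h1 (mul_nonneg hf0 hη)
      _ = _ := by ring
  | V =>
    simp only [stepF]
    have h1 : (1 : ℝ) ≤ 4 * (k : ℝ) ^ 3 := by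
      have : (1 : ℝ) ≤ (k : ℝ) ^ 3 := one_le_pow₀ (by exact_mod_cast hk)
      linarith
    calc (Nat.factorial k : ℝ) * (23 / 20 : ℝ) ^ ((k : ℝ) ^ 2 - Δ)
        = 1 * ((Nat.factorial k : ℝ) * (23 / 20 : ℝ) ^ ((k : ℝ) ^ 2 - Δ)) := by ring
      _ ≤ (4 * (k : ℝ) ^ 3) * ((Nat.factorial k : ℝ) * (23 / 20 : ℝ) ^ ((k : ℝ) ^ 2 - Δ)) :=
          mul_le_mul_of_nonneg_right h1 (mul_nonneg hf0 hη)
      _ = _ := by ring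

/-- **Soundness of `chainCheck`.** Along the list, the side conditions `ChainOK` hold for the real
excesses `Δ_j`, the final bracket encloses `chainΔ`, and the accumulated `L' - L` bounds
`S · log (chainC / C)`; moreover `log (chainC / C) ≥ |l| (log k! + (k² - Δ) log η)`.
[cite: Ford2002, proof of Lemma 6.8] -/
theorem chainCheck_sound {S K k V : ℕ} (hS : 0 < S) (hk : 2 ≤ k) (hV1 : 1 ≤ V) {R : RowLogs}
    (hR : RowLogsOK S k V R) :
    ∀ (l : List Step) (n : ℕ) (Δlo Δhi L : ℤ) (Δ C : ℝ), 0 < C → (Δlo : ℝ) ≤ Δ * S → Δ * S ≤ Δhi →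
      ∀ {n' : ℕ} {Δlo' Δhi' L' : ℤ}, chainCheck S K k V R n Δlo Δhi L l = some (n', Δlo', Δhi', L') →
        ChainOK k (V : ℝ) n Δ l ∧ n' = n + l.length ∧
          (Δlo' : ℝ) ≤ chainΔ k Δ l * S ∧ chainΔ k Δ l * S ≤ Δhi' ∧
          0 < chainC k (23 / 20) V n Δ C l ∧
          Real.log (chainC k (23 / 20) V n Δ C l) * S ≤ Real.log C * S + (L' - L) ∧
          Real.log C + l.length * (Real.log (Nat.factorial k) + ((k : ℝ) ^ 2 - Δ) * Real.log (23 / 20))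
            ≤ Real.log (chainC k (23 / 20) V n Δ C l) := by
  have hk1 : 1 ≤ k := by omega
  have hq := one_sub_inv_mem hk1
  have hη0 : 0 ≤ Real.log (23 / 20 : ℝ) := Real.log_nonneg (by norm_num)
  intro l
  induction l with
  | nil =>
    intro n Δlo Δhi L Δ C hC hlo hhi n' Δlo' Δhi' L' h
    simp only [chainCheck, Option.some.injEq, Prod.mk.injEq] at h
    obtain ⟨rfl, rfl, rfl, rfl⟩ := h
    simp [ChainOK, chainΔ, chainC, hC, hlo, hhi]
  | cons st rest ih =>
    intro n Δlo Δhi L Δ C hC hlo hhi n' Δlo' Δhi' L' h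
    simp only [chainCheck] at h
    split at h
    · rename_i Δlo₁ Δhi₁ c hst
      obtain ⟨hok, hlo₁, hhi₁, hΔ0, hΔk, hcost⟩ := stepCheck_sound hS hk hV1 hR hlo hhi hst
      set C' : ℝ := C * max ((stepThr (V : ℝ) st) ^ Δ) (stepF k (n * k) Δ (23 / 20) st) with hC'
      have hF0 : 0 < stepF k (n * k) Δ (23 / 20) st := by
        have hf0 : (0 : ℝ) < (Nat.factorial k : ℝ) := by exact_mod_cast Nat.factorial_pos k
        exact lt_of_lt_of_le (mul_pos hf0 (Real.rpow_pos_of_pos (by norm_num) _)) (stepF_ge k (n * k) hk1 st)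
      have hmax0 : 0 < max ((stepThr (V : ℝ) st) ^ Δ) (stepF k (n * k) Δ (23 / 20) st) :=
        lt_of_lt_of_le hF0 (le_max_right _ _)
      have hC'0 : 0 < C' := mul_pos hC hmax0
      have hih := ih (n + 1) Δlo₁ Δhi₁ (L + c) (Δ * (1 - 1 / k)) C' hC'0 hlo₁ hhi₁ h
      obtain ⟨hokr, hn', hlo', hhi', hpos, hlog, hlow⟩ := hih
      have eΔ : chainΔ k Δ (st :: rest) = chainΔ k (Δ * (1 - 1 / k)) rest := by
        simp only [chainΔ, List.length_cons, pow_succ']; ring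
      have eC : chainC k (23 / 20) V n Δ C (st :: rest) = chainC k (23 / 20) V (n + 1) (Δ * (1 - 1 / k)) C' rest := by
        simp only [chainC, hC']
      refine ⟨⟨hok, hokr⟩, by rw [hn']; simp; ring, by rw [eΔ]; exact hlo', by rw [eΔ]; exact hhi',
        by rw [eC]; exact hpos, ?_, ?_⟩
      · rw [eC]
        have hlogC' : Real.log C' * S ≤ Real.log C * S + c := by
          rw [hC', Real.log_mul hC.ne' hmax0.ne', add_mul]
          linarith [hcost]
        push_cast at hlog ⊢
        linarith
      · rw [eC]
        have hlogC' : Real.log C + (Real.log (Nat.factorial k) + ((k : ℝ) ^ 2 - Δ) * Real.log (23 / 20))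
            ≤ Real.log C' := by
          rw [hC', Real.log_mul hC.ne' hmax0.ne']
          have h1 := stepF_ge k (n * k) hk1 (Δ := Δ) st
          have hf0 : (0 : ℝ) < (Nat.factorial k : ℝ) := by exact_mod_cast Nat.factorial_pos k
          have h2 : Real.log ((Nat.factorial k : ℝ) * (23 / 20 : ℝ) ^ ((k : ℝ) ^ 2 - Δ))
              ≤ Real.log (max ((stepThr (V : ℝ) st) ^ Δ) (stepF k (n * k) Δ (23 / 20) st)) :=
            Real.log_le_log (by positivity) (h1.trans (le_max_right _ _))
          rw [Real.log_mul hf0.ne' (by positivity), Real.log_rpow (by norm_num)] at h2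
          linarith
        have hmono : (rest.length : ℝ) * (Real.log (Nat.factorial k) + ((k : ℝ) ^ 2 - Δ) * Real.log (23 / 20))
            ≤ rest.length * (Real.log (Nat.factorial k) + ((k : ℝ) ^ 2 - Δ * (1 - 1 / k)) * Real.log (23 / 20)) := by
          refine mul_le_mul_of_nonneg_left ?_ (Nat.cast_nonneg _)
          have : Δ * (1 - 1 / k) ≤ Δ := mul_le_of_le_one_right hΔ0 hq.2
          nlinarith
        simp only [List.length_cons, Nat.cast_succ]
        linarith
    · simp at h

/-! ### Soundness: the row -/

/-- The scaled Taylor terms and partial sums are below `W yⁱ/i!` and `W ∑_{j ≤ i} yʲ/j!`, `y = N/W`.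
[folklore] -/
theorem expLowerScaled_le_sum {W N : ℤ} (hW : 0 < W) (hN : 0 ≤ N) :
    ∀ i : ℕ, 0 ≤ (expLowerScaled W N i).1 ∧
      ((expLowerScaled W N i).1 : ℝ) ≤ W * (((N : ℝ) / W) ^ i / (Nat.factorial i)) ∧
      ((expLowerScaled W N i).2 : ℝ) ≤ W * ∑ j ∈ Finset.range (i + 1), ((N : ℝ) / W) ^ j / (Nat.factorial j)
  | 0 => by
    simp only [expLowerScaled, pow_zero, Nat.factorial_zero, Nat.cast_one, div_one, zero_add,
      Finset.range_one, Finset.sum_singleton, mul_one]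
    exact ⟨hW.le, le_rfl, le_rfl⟩
  | i + 1 => by
    obtain ⟨ht0, ht, hs⟩ := expLowerScaled_le_sum hW hN i
    have hWr : (0 : ℝ) < W := by exact_mod_cast hW
    have hNr : (0 : ℝ) ≤ N := by exact_mod_cast hN
    have hy : 0 ≤ (N : ℝ) / W := div_nonneg hNr hWr.le
    set t : ℤ := (expLowerScaled W N i).1 with htdef
    have hden : (0 : ℤ) < (((i + 1 : ℕ) : ℤ) * W) := mul_pos (by exact_mod_cast Nat.succ_pos i) hW
    have hdenr : (0 : ℝ) < (((i + 1 : ℕ) : ℝ) * W) := by exact_mod_cast hden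
    have e : expLowerScaled W N (i + 1)
        = (t * N / (((i + 1 : ℕ) : ℤ) * W), (expLowerScaled W N i).2 + t * N / (((i + 1 : ℕ) : ℤ) * W)) := by
      simp only [expLowerScaled, htdef]
    have h1 : ((t * N / (((i + 1 : ℕ) : ℤ) * W) : ℤ) : ℝ) ≤ (t : ℝ) * N / (((i + 1 : ℕ) : ℝ) * W) := by
      have := Numerics.fdiv_le_div (a := t * N) hden
      push_cast at this ⊢; exact this
    have h2 : (t : ℝ) * N / (((i + 1 : ℕ) : ℝ) * W) ≤ W * (((N : ℝ) / W) ^ (i + 1) / (Nat.factorial (i + 1))) := by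
      have step : (t : ℝ) * N ≤ W * (((N : ℝ) / W) ^ i / (Nat.factorial i)) * N :=
        mul_le_mul_of_nonneg_right ht hNr
      rw [div_le_iff₀ hdenr]
      refine step.trans (le_of_eq ?_)
      have hW0 : (W : ℝ) ≠ 0 := hWr.ne'
      rw [Nat.factorial_succ, pow_succ]; push_cast
      field_simp
    have h0 : (0 : ℤ) ≤ t * N / (((i + 1 : ℕ) : ℤ) * W) := Int.ediv_nonneg (mul_nonneg ht0 hN) hden.le
    refine ⟨by rw [e]; exact h0, by rw [e]; exact h1.trans h2, ?_⟩
    rw [e]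
    push_cast
    rw [Finset.sum_range_succ, mul_add]
    exact add_le_add hs (h1.trans h2)

/-- `s_i ≤ W e^{N/W}` for the scaled lower Taylor sum. [folklore] -/
theorem expLowerScaled_le {W N : ℤ} (hW : 0 < W) (hN : 0 ≤ N) (i : ℕ) :
    ((expLowerScaled W N i).2 : ℝ) ≤ W * Real.exp ((N : ℝ) / W) := by
  have h := (expLowerScaled_le_sum hW hN i).2.2
  have hWr : (0 : ℝ) < W := by exact_mod_cast hW
  have hy : 0 ≤ (N : ℝ) / W := div_nonneg (by exact_mod_cast hN) hWr.le
  exact h.trans (mul_le_mul_of_nonneg_left (Real.sum_le_exp_of_nonneg hy (i + 1)) hWr.le)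

/-- `log C₀ ≤ log 4 + L₀ + e^{-L₀}/2` for `C₀ = 4 e^{L₀} + 2`. [folklore] -/
theorem log_four_exp_add_two_le (L₀ : ℝ) :
    Real.log (4 * Real.exp L₀ + 2) ≤ Real.log 4 + L₀ + Real.exp (-L₀) / 2 := by
  have hE := Real.exp_pos L₀
  have h1 : 4 * Real.exp L₀ + 2 = (4 * Real.exp L₀) * (1 + Real.exp (-L₀) / 2) := by
    rw [Real.exp_neg]; field_simp; ring
  rw [h1, Real.log_mul (by positivity) (by positivity), Real.log_mul (by norm_num) hE.ne', Real.log_exp]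
  have h2 : Real.log (1 + Real.exp (-L₀) / 2) ≤ Real.exp (-L₀) / 2 := by
    have := Real.log_le_sub_one_of_pos (show 0 < 1 + Real.exp (-L₀) / 2 by positivity)
    linarith
  linarith

/-- `e^{-x} ≤ 1/(1+y)` for `0 ≤ y ≤ x`. [folklore] -/
theorem exp_neg_le_inv {x y : ℝ} (hy : 0 ≤ y) (hxy : y ≤ x) : Real.exp (-x) ≤ 1 / (1 + y) := by
  rw [Real.exp_neg, inv_eq_one_div]
  apply one_div_le_one_div_of_le (by linarith)
  linarith [Real.add_one_le_exp x]

set_option maxHeartbeats 3200000 in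
/-- **Soundness of the row checker.** If `rowCheck k n₀ V l = true` then the structural hypotheses of
`row_of_chain` hold, the side conditions `ChainOK` hold along `l` for `Δ₀ = k(k-1)/2`, the threshold
`V` qualifies for the `k³`-prime windows, the exponent condition `d₁ ≤ c` holds, and the row constant
satisfies `C₀^{d₁/c} ≤ C`. [cite: Ford2002, Lemma 6.8 (Table 6.1)] -/
theorem rowCheck_sound {C k n₀ V : ℕ} {l : List Step} (h : rowCheck C k n₀ V l = true) :
    4 ≤ k ∧ 1 ≤ n₀ ∧ (k : ℝ) * (k + 1) / 2 ≤ 2 * (n₀ * k : ℕ) ∧ (k : ℝ) + 1 ≤ V ∧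
      16 * (k : ℝ) ^ 4 ≤ (V : ℝ) ^ k ∧ (100000000 : ℝ) ≤ V ∧
      (k : ℝ) ^ 3 ≤ V / (200 * Real.log (23 / 20 * V)) ∧
      ChainOK k (V : ℝ) n₀ ((k : ℝ) * ((k : ℝ) - 1) / 2) l ∧
      1 / (133.66 * ((k : ℝ) - 1) ^ 2)
        ≤ (1 - (2 + 2 * chainΔ k ((k : ℝ) * ((k : ℝ) - 1) / 2) l) / (k + 1)) / (2 * (((n₀ + l.length) * k : ℕ) : ℝ)) ∧
      (4 * ((Nat.factorial k : ℝ) * (2 * Real.pi * k) ^ k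
            * chainC k (23 / 20) V n₀ ((k : ℝ) * ((k : ℝ) - 1) / 2) (Nat.factorial k) l)
              ^ (1 / (2 * (((n₀ + l.length) * k : ℕ) : ℝ))) + 2)
          ^ ((1 / (133.66 * ((k : ℝ) - 1) ^ 2))
              / ((1 - (2 + 2 * chainΔ k ((k : ℝ) * ((k : ℝ) - 1) / 2) l) / (k + 1))
                  / (2 * (((n₀ + l.length) * k : ℕ) : ℝ)))) ≤ C := by
  have hS : 0 < SC := by unfold SC; positivity
  have hSr : (0 : ℝ) < SC := by exact_mod_cast hS
  simp only [rowCheck] at h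
  split at h
  · simp at h
  · rename_i R hR
    split at h
    · simp at h
    · rename_i n Δlo Δhi L hchain
      simp only [Bool.and_eq_true, decide_eq_true_eq] at h
      obtain ⟨hAB, hC, hD, hfin⟩ := h
      obtain ⟨hA, hB⟩ := hAB
      obtain ⟨hk4, hn₀, hn₀k, hkV, hV16, hV8⟩ := hA
      obtain ⟨hLw0, hwin⟩ := hB
      obtain ⟨hApos, hdc⟩ := hC
      obtain ⟨-, hN0lo, hEs⟩ := hD
      split at hfin
      · simp at hfin
      · rename_i LC hLC
        simp only [decide_eq_true_eq] at hfin
        have hRok := mkRowLogs_sound hS hR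
        obtain ⟨hL2, hLk, hLf, hLeta, hLV, hLpi⟩ := hRok
        have hmLC := MI.mem_logNat2 hS hLC
        have hCpos : (0 : ℝ) < C := by
          have hC0 : C ≠ 0 := by rintro rfl; simp [MI.logNat2] at hLC
          exact_mod_cast Nat.pos_of_ne_zero hC0
        have hk2 : 2 ≤ k := le_trans (by norm_num) hk4
        have hk1 : 1 ≤ k := le_trans (by norm_num) hk4
        have hkr : (4 : ℝ) ≤ k := by exact_mod_cast hk4
        have hV1 : 1 ≤ V := le_trans (by norm_num) hV8
        have hVr : (100000000 : ℝ) ≤ V := by exact_mod_cast hV8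
        -- the start bracket is exact
        set Δ₀ : ℝ := (k : ℝ) * ((k : ℝ) - 1) / 2 with hΔ₀
        have hΔ0int : ((((k * (k - 1) / 2 : ℕ) : ℤ) * (SC : ℕ) : ℤ) : ℝ) = Δ₀ * SC := by
          simp only [Int.cast_mul, Int.cast_natCast]
          rw [cast_mul_pred_div_two]
        have hf0 : (0 : ℝ) < (Nat.factorial k : ℝ) := by exact_mod_cast Nat.factorial_pos k
        have hcs := chainCheck_sound hS hk2 hV1 ⟨hL2, hLk, hLf, hLeta, hLV, hLpi⟩ l n₀ _ _ 0 Δ₀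
          (Nat.factorial k) hf0 hΔ0int.le hΔ0int.ge hchain
        obtain ⟨hok, hn, hflo, hfhi, hCf0, hlogCf, hlowCf⟩ := hcs
        -- structural facts
        refine ⟨hk4, hn₀, ?_, ?_, ?_, hVr, ?_, hok, ?_, ?_⟩
        · have : ((k * (k + 1) : ℕ) : ℝ) ≤ ((4 * (n₀ * k) : ℕ) : ℝ) := by exact_mod_cast hn₀k
          push_cast at this ⊢; linarith
        · exact_mod_cast hkV
        · exact_mod_cast hV16
        · -- the window condition
          have hη : Real.log (23 / 20 * (V : ℝ)) = Real.log V + Real.log (23 / 20) := by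
            rw [mul_comm, Real.log_mul (by positivity) (by norm_num)]
          have hlogpos : 0 < Real.log (23 / 20 * (V : ℝ)) := Real.log_pos (by linarith)
          rw [le_div_iff₀ (by positivity)]
          have h1 : Real.log (23 / 20 * (V : ℝ)) * SC ≤ (R.LV.hi : ℝ) + R.Leta.hi := by
            rw [hη, add_mul]; exact add_le_add hLV.2 hLeta.2
          have h2 : (200 : ℝ) * (k : ℝ) ^ 3 * ((R.LV.hi : ℝ) + R.Leta.hi) ≤ (V : ℝ) * SC := by
            have := hwin; exact_mod_cast this
          have h3 : (k : ℝ) ^ 3 * (200 * Real.log (23 / 20 * V)) * SC ≤ (V : ℝ) * SC := by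
            have hk30 : (0 : ℝ) ≤ 200 * (k : ℝ) ^ 3 := by positivity
            nlinarith [mul_le_mul_of_nonneg_left h1 hk30]
          exact le_of_mul_le_mul_right h3 hSr
        · -- the exponent condition
          set Δf : ℝ := chainΔ k Δ₀ l with hΔf
          have hΔfhi : Δf * SC ≤ Δhi := hfhi
          have hApos' : (0 : ℝ) < ((k : ℝ) - 1) * SC - 2 * Δhi := by
            have := hApos
            have h' : (0 : ℝ) < (((k - 1 : ℕ) : ℤ) : ℝ) * SC - 2 * Δhi := by exact_mod_cast this
            rwa [show (((k - 1 : ℕ) : ℤ) : ℝ) = (k : ℝ) - 1 by push_cast [Nat.cast_sub hk1]; ring] at h'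
          have hdc' : (100 : ℝ) * ((k : ℝ) + 1) * SC * (2 * (((n₀ + l.length) * k : ℕ) : ℝ))
              ≤ 13366 * ((k : ℝ) - 1) ^ 2 * (((k : ℝ) - 1) * SC - 2 * Δhi) := by
            have := hdc
            have h' : ((100 * ((k + 1 : ℕ) : ℤ) * (SC : ℕ) * ((2 * n * k : ℕ) : ℤ) : ℤ) : ℝ)
                ≤ ((13366 * (((k - 1) ^ 2 : ℕ) : ℤ) * ((((k - 1 : ℕ) : ℤ) * (SC : ℕ) - 2 * Δhi)) : ℤ) : ℝ) := by
              exact_mod_cast this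
            push_cast [Nat.cast_sub hk1] at h'
            rw [hn] at h'
            convert h' using 2; push_cast; ring
          have hnk0 : (0 : ℝ) < 2 * (((n₀ + l.length) * k : ℕ) : ℝ) := by
            have : 1 ≤ (n₀ + l.length) * k := Nat.one_le_iff_ne_zero.2 (by positivity)
            have : (1 : ℝ) ≤ (((n₀ + l.length) * k : ℕ) : ℝ) := by exact_mod_cast this
            linarith
          rw [div_le_div_iff₀ (by nlinarith) hnk0]
          -- `2·2nk·? `: we show `2nk ≤ 133.66 (k-1)² (1 - (2+2Δf)/(k+1))`
          have hk1r : (0 : ℝ) < (k : ℝ) + 1 := by linarith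
          have key : (1 : ℝ) * (2 * (((n₀ + l.length) * k : ℕ) : ℝ))
              ≤ (1 - (2 + 2 * Δf) / (k + 1)) * (133.66 * ((k : ℝ) - 1) ^ 2) := by
            rw [show (1 - (2 + 2 * Δf) / ((k : ℝ) + 1)) = (((k : ℝ) - 1) - 2 * Δf) / (k + 1) by
              field_simp; ring]
            rw [div_mul_eq_mul_div, le_div_iff₀ hk1r]
            -- from `hdc'` divided by `100 · SC`, and `Δf ≤ Δhi/SC`
            have h5 : ((k : ℝ) - 1) * SC - 2 * Δhi ≤ (((k : ℝ) - 1) - 2 * Δf) * SC := by nlinarith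
            have h6 : 13366 * ((k : ℝ) - 1) ^ 2 * (((k : ℝ) - 1) * SC - 2 * Δhi)
                ≤ 13366 * ((k : ℝ) - 1) ^ 2 * ((((k : ℝ) - 1) - 2 * Δf) * SC) :=
              mul_le_mul_of_nonneg_left h5 (by positivity)
            have h7 := hdc'.trans h6
            -- divide by `SC`
            have h8 : (100 : ℝ) * ((k : ℝ) + 1) * (2 * (((n₀ + l.length) * k : ℕ) : ℝ))
                ≤ 13366 * ((k : ℝ) - 1) ^ 2 * (((k : ℝ) - 1) - 2 * Δf) := by
              have : (100 : ℝ) * ((k : ℝ) + 1) * (2 * (((n₀ + l.length) * k : ℕ) : ℝ)) * SC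
                  ≤ 13366 * ((k : ℝ) - 1) ^ 2 * (((k : ℝ) - 1) - 2 * Δf) * SC := by nlinarith
              exact le_of_mul_le_mul_right this hSr
            nlinarith
          linarith
        · -- the final constant
          set Δf : ℝ := chainΔ k Δ₀ l with hΔf
          set Cf : ℝ := chainC k (23 / 20) V n₀ Δ₀ (Nat.factorial k) l with hCf
          set m : ℝ := 2 * (((n₀ + l.length) * k : ℕ) : ℝ) with hm
          have hmn : ((2 * n * k : ℕ) : ℝ) = m := by rw [hn, hm]; push_cast; ring
          have hmn' : (2 : ℝ) * (n : ℝ) * (k : ℝ) = m := by have := hmn; push_cast at this; exact this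
          have hm0 : 0 < m := by
            have : 1 ≤ (n₀ + l.length) * k := Nat.one_le_iff_ne_zero.2 (by positivity)
            have : (1 : ℝ) ≤ (((n₀ + l.length) * k : ℕ) : ℝ) := by exact_mod_cast this
            rw [hm]; linarith
          set half : ℕ := k * (k + 1) / 2 with hhalf
          have hhalfR : (half : ℝ) = (k : ℝ) * ((k : ℝ) + 1) / 2 := cast_mul_succ_div_two k
          -- the quantity `X = k! (2πk)^k Cf` and `N₀ = log X`, `L₀ = N₀/m`
          have hpi := Real.pi_pos
          set X : ℝ := (Nat.factorial k : ℝ) * (2 * Real.pi * k) ^ k * Cf with hX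
          have hX0 : 0 < X := by positivity
          set N₀ : ℝ := Real.log X with hN₀
          have hN₀eq : N₀ = Real.log (Nat.factorial k) + k * (Real.log 2 + Real.log Real.pi + Real.log k)
              + Real.log Cf := by
            rw [hN₀, hX, Real.log_mul (by positivity) hCf0.ne', Real.log_mul hf0.ne' (by positivity),
              Real.log_pow, Real.log_mul (by positivity) (by positivity), Real.log_mul (by norm_num) hpi.ne']
          set L₀ : ℝ := N₀ / m with hL₀
          have hroot : X ^ (1 / m) = Real.exp L₀ := by
            rw [Real.rpow_def_of_pos hX0, hL₀, hN₀]; congr 1; field_simp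
          -- `N₀ · SC ≤ N0hi`, `N0lo ≤ N₀ · SC`, `0 ≤ N0lo`
          have hlogk0 : 0 ≤ Real.log (k : ℝ) := Real.log_nonneg (by linarith)
          have hlogf0 : 0 ≤ Real.log (Nat.factorial k : ℝ) :=
            Real.log_nonneg (by exact_mod_cast Nat.one_le_iff_ne_zero.2 (Nat.factorial_ne_zero k))
          have hlog2pik : 0 ≤ Real.log 2 + Real.log Real.pi + Real.log k := by
            have : 0 ≤ Real.log Real.pi := Real.log_nonneg (by linarith [Real.pi_gt_three])
            have : 0 ≤ Real.log (2 : ℝ) := Real.log_nonneg (by norm_num)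
            linarith
          have hNhi : N₀ * SC ≤ (R.Lfact.hi : ℝ) + k * ((R.L2.hi : ℝ) + R.Lpi.hi + R.Lk.hi) + R.Lfact.hi + L := by
            have e1 := hLf.2; have e2 := hL2.2; have e3 := hLpi.2; have e4 := hLk.2
            have e5 : Real.log Cf * SC ≤ Real.log (Nat.factorial k) * SC + L := by
              have := hlogCf; simp only [Int.cast_zero, sub_zero] at this; exact this
            have hk0 : (0 : ℝ) ≤ k := Nat.cast_nonneg k
            have e6 : (k : ℝ) * ((Real.log 2 + Real.log Real.pi + Real.log k) * SC)
                ≤ k * ((R.L2.hi : ℝ) + R.Lpi.hi + R.Lk.hi) :=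
              mul_le_mul_of_nonneg_left (by nlinarith) hk0
            rw [hN₀eq]; nlinarith
          have hN0lo_le : ((l.length : ℕ) : ℝ) * ((R.Lfact.lo : ℝ) + (half : ℝ) * R.Leta.lo) ≤ N₀ * SC := by
            have e1 := hLf.1; have e2 := hLeta.1
            have hη0 : 0 ≤ Real.log (23 / 20 : ℝ) := Real.log_nonneg (by norm_num)
            have hhalf0 : (0 : ℝ) ≤ half := Nat.cast_nonneg _
            have e3 : (half : ℝ) * (R.Leta.lo : ℝ) ≤ half * (Real.log (23 / 20) * SC) :=
              mul_le_mul_of_nonneg_left e2 hhalf0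
            have e4 : ((l.length : ℕ) : ℝ) * ((R.Lfact.lo : ℝ) + (half : ℝ) * R.Leta.lo)
                ≤ (l.length : ℝ) * ((Real.log (Nat.factorial k) + ((k : ℝ) ^ 2 - Δ₀) * Real.log (23 / 20)) * SC) := by
              refine mul_le_mul_of_nonneg_left ?_ (Nat.cast_nonneg _)
              rw [show (k : ℝ) ^ 2 - Δ₀ = half by rw [hhalfR, hΔ₀]; ring]
              nlinarith
            have e5 : Real.log Cf ≤ N₀ := by
              rw [hN₀eq]
              have : 0 ≤ (k : ℝ) * (Real.log 2 + Real.log Real.pi + Real.log k) := by positivity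
              linarith
            have e6 := hlowCf
            nlinarith
          have hN0lo0 : (0 : ℝ) ≤ ((l.length : ℕ) : ℝ) * ((R.Lfact.lo : ℝ) + (half : ℝ) * R.Leta.lo) := by
            have := hN0lo; exact_mod_cast this
          have hN₀0 : 0 ≤ N₀ := by nlinarith
          have hL₀0 : 0 ≤ L₀ := div_nonneg hN₀0 hm0.le
          -- `C₀` and its logarithm
          set C₀ : ℝ := 4 * Real.exp L₀ + 2 with hC₀
          have hC₀2 : 2 ≤ C₀ := by have := Real.exp_pos L₀; rw [hC₀]; linarith
          have hlogC₀0 : 0 ≤ Real.log C₀ := Real.log_nonneg (by linarith)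
          set L₀lo : ℝ := ((l.length : ℕ) : ℝ) * ((R.Lfact.lo : ℝ) + (half : ℝ) * R.Leta.lo) / (SC * m) with hL₀lo
          have hL₀lo0 : 0 ≤ L₀lo := div_nonneg hN0lo0 (by positivity)
          have hL₀lo_le : L₀lo ≤ L₀ := by
            rw [hL₀lo, hL₀, div_le_div_iff₀ (by positivity) hm0]
            nlinarith
          have hlogC₀ : Real.log C₀ ≤ Real.log 4 + L₀ + Real.exp (-L₀lo) / 2 := by
            have h1 := log_four_exp_add_two_le L₀
            have h2 : Real.exp (-L₀) ≤ Real.exp (-L₀lo) := Real.exp_le_exp.2 (by linarith)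
            linarith
          -- `ρ ≤ lhs/rhs`
          set lhs : ℝ := 100 * ((k : ℝ) + 1) * SC * m with hlhs
          set rhs : ℝ := 13366 * ((k : ℝ) - 1) ^ 2 * (((k : ℝ) - 1) * SC - 2 * Δhi) with hrhs
          have hApos' : (0 : ℝ) < ((k : ℝ) - 1) * SC - 2 * Δhi := by
            have h' : (0 : ℝ) < (((k - 1 : ℕ) : ℤ) : ℝ) * SC - 2 * Δhi := by exact_mod_cast hApos
            rwa [show (((k - 1 : ℕ) : ℤ) : ℝ) = (k : ℝ) - 1 by push_cast [Nat.cast_sub hk1]; ring] at h'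
          have hrhs0 : 0 < rhs := by
            rw [hrhs]; exact mul_pos (mul_pos (by norm_num) (pow_pos (by linarith) 2)) hApos'
          have hlhs0 : 0 < lhs := by rw [hlhs]; positivity
          set ρ : ℝ := (1 / (133.66 * ((k : ℝ) - 1) ^ 2)) / ((1 - (2 + 2 * Δf) / (k + 1)) / m) with hρ
          have hΔfhi : Δf * SC ≤ Δhi := hfhi
          have hc_lo : (((k : ℝ) - 1) * SC - 2 * Δhi) / (((k : ℝ) + 1) * SC * m) ≤ (1 - (2 + 2 * Δf) / (k + 1)) / m := by
            rw [div_le_div_iff₀ (by positivity) hm0]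
            have : (1 - (2 + 2 * Δf) / ((k : ℝ) + 1)) * (((k : ℝ) + 1) * SC * m)
                = (((k : ℝ) - 1) - 2 * Δf) * SC * m := by field_simp; ring
            rw [this]; nlinarith
          have hc_lo0 : 0 < (((k : ℝ) - 1) * SC - 2 * Δhi) / (((k : ℝ) + 1) * SC * m) := by positivity
          have hρle : ρ ≤ lhs / rhs := by
            rw [hρ]
            calc (1 / (133.66 * ((k : ℝ) - 1) ^ 2)) / ((1 - (2 + 2 * Δf) / (k + 1)) / m)
                ≤ (1 / (133.66 * ((k : ℝ) - 1) ^ 2)) / ((((k : ℝ) - 1) * SC - 2 * Δhi) / (((k : ℝ) + 1) * SC * m)) :=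
                  div_le_div_of_nonneg_left (by positivity) hc_lo0 hc_lo
              _ = lhs / rhs := by
                  rw [hlhs, hrhs, show (133.66 : ℝ) = 13366 / 100 by norm_num]
                  field_simp
          have hpos : 0 < (1 - (2 + 2 * Δf) / ((k : ℝ) + 1)) / m := lt_of_lt_of_le hc_lo0 hc_lo
          have ha : 0 < 1 - (2 + 2 * Δf) / ((k : ℝ) + 1) := by
            have h := mul_pos hpos hm0; rwa [div_mul_cancel₀ _ hm0.ne'] at h
          have hρ0 : 0 ≤ ρ := by rw [hρ]; exact div_nonneg (by positivity) (div_nonneg ha.le hm0.le)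
          -- names for the integer quantities of the final test
          set N0loz : ℤ := ((l.length : ℕ) : ℤ) * (R.Lfact.lo + (half : ℤ) * R.Leta.lo) with hN0loz
          set Wz : ℤ := ((SC * (2 * n * k) : ℕ) : ℤ) with hWz
          set Esz : ℤ := (expLowerScaled Wz N0loz 12).2 with hEsz
          set Tz : ℤ := Numerics.cdiv (Wz * Wz) (2 * Esz) with hTz
          have hWzR : (Wz : ℝ) = SC * m := by rw [hWz]; push_cast; rw [hmn']
          -- the final integer inequality, read in `ℝ`
          have hfinR : lhs * ((2 * (R.L2.hi : ℝ)) * m + ((R.Lfact.hi : ℝ) + k * ((R.L2.hi : ℝ) + R.Lpi.hi + R.Lk.hi) + R.Lfact.hi + L)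
              + (Tz : ℝ)) ≤ rhs * m * (LC.lo : ℝ) := by
            have h' := hfin
            have h'' : ((100 * ((k + 1 : ℕ) : ℤ) * (SC : ℕ) * ((2 * n * k : ℕ) : ℤ) *
                (2 * R.L2.hi * ((2 * n * k : ℕ) : ℤ) + (R.Lfact.hi + (k : ℤ) * (R.L2.hi + R.Lpi.hi + R.Lk.hi) + R.Lfact.hi + L) +
                  Tz) : ℤ) : ℝ)
                ≤ ((13366 * (((k - 1) ^ 2 : ℕ) : ℤ) * ((((k - 1 : ℕ) : ℤ) * (SC : ℕ) - 2 * Δhi)) * ((2 * n * k : ℕ) : ℤ) *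
                    LC.lo : ℤ) : ℝ) := by exact_mod_cast h'
            rw [hlhs, hrhs, ← hmn]
            push_cast [Nat.cast_sub hk1] at h'' ⊢
            convert h'' using 2
          -- `T ≥ W e^{-L₀lo}/2`, `W = SC·m`, via `Es ≤ W e^{L₀lo}`
          have hWz0 : 0 < Wz := by
            have : (0 : ℝ) < (Wz : ℝ) := by rw [hWzR]; positivity
            exact_mod_cast this
          have hN0z0 : 0 ≤ N0loz := by have := hN0lo; exact_mod_cast this
          have hEs0 : 0 < Esz := by have := hEs; exact_mod_cast this
          have hEs0R : (0 : ℝ) < Esz := by exact_mod_cast hEs0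
          have hN0lozR : (N0loz : ℝ) = ((l.length : ℕ) : ℝ) * ((R.Lfact.lo : ℝ) + (half : ℝ) * R.Leta.lo) := by
            rw [hN0loz]; push_cast; ring
          have hEsle : (Esz : ℝ) ≤ SC * m * Real.exp L₀lo := by
            have h1 := expLowerScaled_le hWz0 hN0z0 12
            rw [← hEsz, hWzR, hN0lozR] at h1
            rw [hL₀lo]; exact h1
          have hthird : Real.exp (-L₀lo) / 2 ≤ (Tz : ℝ) / (SC * m) := by
            have hSm : (0 : ℝ) < SC * m := by positivity
            have hE := Real.exp_pos L₀lo
            -- `e^{-L₀lo}/2 = (SC m)/(2 (SC m) e^{L₀lo}) ≤ (SC m)/(2 Es) ≤ Tz/(SC m)`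
            have h1 : Real.exp (-L₀lo) / 2 ≤ (SC * m) / (2 * Esz) := by
              rw [Real.exp_neg, div_le_div_iff₀ (by norm_num) (by positivity)]
              have : (Esz : ℝ) * 2 ≤ SC * m * Real.exp L₀lo * 2 := by nlinarith
              calc (Real.exp L₀lo)⁻¹ * (2 * Esz) = (Esz * 2) / Real.exp L₀lo := by field_simp
                _ ≤ (SC * m * Real.exp L₀lo * 2) / Real.exp L₀lo := div_le_div_of_nonneg_right this hE.le
                _ = SC * m * 2 := by field_simp
            have h2 : (SC * m) / (2 * Esz) ≤ (Tz : ℝ) / (SC * m) := by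
              rw [div_le_div_iff₀ (by positivity) hSm]
              have h3 := Numerics.div_le_cdiv (a := Wz * Wz) (b := 2 * Esz) (by positivity)
              rw [← hTz] at h3
              have h4 : ((Wz * Wz : ℤ) : ℝ) / ((2 * Esz : ℤ) : ℝ) * (2 * Esz) ≤ (Tz : ℝ) * (2 * Esz) :=
                mul_le_mul_of_nonneg_right h3 (by positivity)
              have e5 : ((Wz * Wz : ℤ) : ℝ) / ((2 * Esz : ℤ) : ℝ) * (2 * Esz) = SC * m * (SC * m) := by
                push_cast; rw [hWzR]; field_simp
              rw [e5] at h4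
              linarith
            exact h1.trans h2
          -- assemble: `ρ log C₀ ≤ log C`
          have hlog4 : Real.log 4 * SC ≤ 2 * (R.L2.hi : ℝ) := by
            rw [show (4 : ℝ) = 2 ^ 2 by norm_num, Real.log_pow]
            have := hL2.2
            push_cast; linarith
          have hlogC : (LC.lo : ℝ) ≤ Real.log C * SC := by have := hmLC.1; exact_mod_cast this
          have hbracket : Real.log 4 + L₀ + Real.exp (-L₀lo) / 2
              ≤ ((2 * (R.L2.hi : ℝ)) * m + ((R.Lfact.hi : ℝ) + k * ((R.L2.hi : ℝ) + R.Lpi.hi + R.Lk.hi) + R.Lfact.hi + L)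
                  + (Tz : ℝ)) / (SC * m) := by
            rw [le_div_iff₀ (by positivity)]
            have e1 : L₀ * (SC * m) = N₀ * SC := by rw [hL₀]; field_simp
            have e2 : Real.exp (-L₀lo) / 2 * (SC * m) ≤ (Tz : ℝ) := by
              have := hthird; rwa [le_div_iff₀ (by positivity)] at this
            have e3 : Real.log 4 * SC * m ≤ 2 * (R.L2.hi : ℝ) * m := mul_le_mul_of_nonneg_right hlog4 hm0.le
            have e4 : L₀ * (SC * m) ≤ (R.Lfact.hi : ℝ) + k * ((R.L2.hi : ℝ) + R.Lpi.hi + R.Lk.hi) + R.Lfact.hi + L := by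
              rw [e1]; exact hNhi
            have expand : (Real.log 4 + L₀ + Real.exp (-L₀lo) / 2) * (SC * m)
                = Real.log 4 * SC * m + L₀ * (SC * m) + Real.exp (-L₀lo) / 2 * (SC * m) := by ring
            rw [expand]; linarith
          have hmain : ρ * Real.log C₀ ≤ Real.log C := by
            have h1 : ρ * Real.log C₀ ≤ (lhs / rhs) * (Real.log 4 + L₀ + Real.exp (-L₀lo) / 2) :=
              mul_le_mul hρle hlogC₀ hlogC₀0 (div_nonneg hlhs0.le hrhs0.le)
            have h2 : (lhs / rhs) * (Real.log 4 + L₀ + Real.exp (-L₀lo) / 2)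
                ≤ (lhs / rhs) * (((2 * (R.L2.hi : ℝ)) * m + ((R.Lfact.hi : ℝ) + k * ((R.L2.hi : ℝ) + R.Lpi.hi + R.Lk.hi) + R.Lfact.hi + L)
                  + (Tz : ℝ)) / (SC * m)) := mul_le_mul_of_nonneg_left hbracket (by positivity)
            have h3 : (lhs / rhs) * (((2 * (R.L2.hi : ℝ)) * m + ((R.Lfact.hi : ℝ) + k * ((R.L2.hi : ℝ) + R.Lpi.hi + R.Lk.hi) + R.Lfact.hi + L)
                  + (Tz : ℝ)) / (SC * m)) ≤ (LC.lo : ℝ) / SC := by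
              rw [div_mul_div_comm, div_le_div_iff₀ (by positivity) hSr]
              calc lhs * ((2 * (R.L2.hi : ℝ)) * m + ((R.Lfact.hi : ℝ) + k * ((R.L2.hi : ℝ) + R.Lpi.hi + R.Lk.hi) + R.Lfact.hi + L)
                    + (Tz : ℝ)) * SC ≤ (rhs * m * (LC.lo : ℝ)) * SC :=
                    mul_le_mul_of_nonneg_right hfinR hSr.le
                _ = _ := by ring
            have h4 : (LC.lo : ℝ) / SC ≤ Real.log C := by
              rw [div_le_iff₀ hSr]; exact hlogC
            linarith
          -- conclude
          have hfinal : C₀ ^ ρ ≤ C := by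
            have hC₀0 : 0 < C₀ := by linarith
            rw [Real.rpow_def_of_pos hC₀0, show (C : ℝ) = Real.exp (Real.log C) by rw [Real.exp_log hCpos]]
            exact Real.exp_le_exp.2 (by rw [mul_comm]; exact hmain)
          have hshape : (4 * ((Nat.factorial k : ℝ) * (2 * Real.pi * k) ^ k * Cf) ^ (1 / m) + 2) ^ ρ = C₀ ^ ρ := by
            rw [hC₀, ← hX, hroot]
          rw [hshape]
          exact hfinal

end FordVK
end Literature.NumberTheory.LFunctions
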